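import Literature.Probability.Percolation.KhSThreeDisorderCrossingArcs
import HarnessLib

/-!
# Khristoforov–Smirnov at `k = 3`: the observable is MONOTONE along each boundary arc

Topic `Literature/Probability/Percolation`; three-disorder lineage (after `KhSThreeDisorderCrossing` / `…CrossingBonds` /
`…CrossingArcs`: Khristoforov–Smirnov's eq. (4), percolation side, at every boundary mid-edge of every arc). The discrete
input of the boundary-correspondence step of §3 of the paper («`F` maps `∂_jΩ` into the segment `[τ^{j−1}, τ^{j+1}]`», and in the
limit the boundary values wind ONCE around the triangle): as the boundary mid-edge `z` ADVANCES along the arc `A_a` (anticlockwise,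
from the mark `v_a` towards `v_{a+1}`), the sub-arc `∂_{y_a z}` grows, hence so does the crossing event `∂_{y_a z} ↔ A_{a+1}` and its
probability `H_{a+1}(z)` (eq. (4)); `H_a(z) = 1 − H_{a+1}(z)` decreases; and `F(z) = τ^a + (τ^{a+1} − τ^a)·H_{a+1}(z)` moves MONOTONICALLY
along the segment from `τ^a` towards `τ^{a+1}`. All statements hold at EVERY boundary mid-edge (no hypothesis on the face at which
`z` is read), for every 3-marked discrete domain `D : TriMarkedDomain 3`:

* `dpos_facts_of_mem_stretch`, `arcToA_eq_image` — a dart of the stretch `A_a` sits at a position `pos a ≤ p < nextPos a` of the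
  boundary cycle, and the sub-arc `∂_{y_a z}` (`arcToA`) is the set of tails of the darts at positions `pos a, …, p`;
* `arcToA_mono`, `arcToCrossingA_mono` — the sub-arc and the crossing event grow with the position;
* ★ `hobs_succ_mono` — `p ≤ p' ⇒ H_{a+1}(z) ≤ H_{a+1}(z')`; `hobs_self_anti` — `H_a(z') ≤ H_a(z)`;
* `fobs_eq_affine` — `F(z) = τ^a + (τ^{a+1} − τ^a)·H_{a+1}(z)`; ★ `fobs_sub_fobs` — `F(z') − F(z) = (τ^{a+1} − τ^a)·(H_{a+1}(z') − H_{a+1}(z))`,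
  a NON-NEGATIVE real multiple of the side vector `τ^{a+1} − τ^a` (`fobs_monotone_on_arc`);
* (T-SITE at `k = 3`) `fst_bdart_eq_of_between₃` (the run of a boundary hexagon inside a stretch, from `TriMarkedDomain.tail_not_interleaved`),
  `arcToA_eq_of_fst_eq`, ★ `hobs_site_law₃`, `fobs_site_law₃` — two boundary mid-edges of `A_a` around the SAME hexagon `H_g` carry the same
  `H_j` and the same `F`: the boundary trace is a function of the boundary hexagon (the `k = 3` twin of `Bdry.boundarySiteLaw_holds`).

## References
* M. Khristoforov, S. Smirnov, *Percolation and O(1) loop model*, arXiv:2111.15612 (2021): §1.2 Lemma 2 (v1 pp. 2–3), §2 eq. (4) with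
  Remark 6 (p. 5); §3 (pp. 5–6: the boundary values of the limit traverse `∂` of the triangle) — the monotonicity itself is not stated in
  print (it is the evident monotonicity of a crossing event in its source arc); recorded here as the lattice fact the boundary argument uses.
* B. Bollobás, O. Riordan, *Percolation*, CUP (2006), Ch. 7 §7.2.2 (pp. 191–195): marked discrete domains, arcs with both endpoints.

## Mathlib / tree
Mathlib: `MeasureTheory.measureReal_mono`. Tree: `KhSThreeDisorderCrossingArcs.lean` (`arcToA`, `arcToCrossingA`, `hobs_eq_prob_of_mem_stretch'`,
`fobs_eq_crossingProbs_of_mem_stretch'`), `KhSThreeDisorderCrossing.lean` (`bdart`, `bdart_mem`, `dpos_bdart`), `TriDiscInterface.lean` (`dpos`,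
`dpos_eq_of_iter_eq`, `dpos_iter`), `TriDiscShelling.lean` (`triBdryIter_add`), `TriDiscreteDomain.lean` (`stretch`, `markDart`, `mem_triBdryDarts`),
`TriDiscSeparation.lean` (`TriMarkedDomain.tail_not_interleaved`), `TriIface3.lean` (`nextPos_of_lt₃`); the run lemma follows
`FivePointBoundarySite.lean` (`fst_iter_eq_of_between`, five marks) line by line with three marks.
-/

open Finset MeasureTheory

namespace Literature.Probability.Percolation.MarkedLoops

open Literature.Probability.Percolation Literature.Probability.LatticeModels
open Literature.Probability.Percolation.FivePoint (side tau)
open TriMarkedDomain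

section Monotone

variable {D : TriMarkedDomain 3}

/-! ### positions of the darts of a stretch -/

/-- a dart of the stretch `A_a` sits at a position `pos a ≤ p < nextPos a ≤ L` of the boundary cycle, is `bdart p`, and is a boundary
dart. [cite: BollobasRiordan2006, Ch. 7 §7.2.2 pp. 191–193] -/
theorem dpos_facts_of_mem_stretch {a : Fin 3} {d : Site 2 × Site 2} (hd : d ∈ D.stretch a) :
    D.pos a ≤ D.dpos d ∧ D.dpos d < D.nextPos a ∧ D.dpos d < #(triBdryDarts D.verts) ∧ bdart D (D.dpos d) = d ∧
      d ∈ triBdryDarts D.verts := by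
  unfold TriMarkedDomain.stretch at hd
  obtain ⟨n, hn, rfl⟩ := Finset.mem_image.1 hd
  rw [Finset.mem_Ico] at hn
  have hnL : n < #(triBdryDarts D.verts) := lt_of_lt_of_le hn.2 (D.nextPos_le_bdryLen a)
  have hdp : D.dpos (triBdryIter D.verts D.base n) = n := by rw [D.dpos_iter, Nat.mod_eq_of_lt hnL]
  rw [hdp]
  exact ⟨hn.1, hn.2, hnL, rfl, bdart_mem n⟩

/-- the darts of a stretch have their tail in `G`, their head outside, and are bonds of `𝕋`. [cite: BollobasRiordan2006, Ch. 7 §7.2.2 pp. 191–193] -/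
theorem dart_facts_of_mem_stretch {a : Fin 3} {g o : Site 2} (hd : (g, o) ∈ D.stretch a) :
    g ∈ D.verts ∧ o ∉ D.verts ∧ triGraph.Adj g o :=
  mem_triBdryDarts.1 (dpos_facts_of_mem_stretch hd).2.2.2.2

/-- iterating from the marked dart of `A_a` walks the positions `pos a + t`. [cite: BollobasRiordan2006, Ch. 7 §7.2.2 pp. 191–193] -/
theorem iter_markDart_eq_bdart (a : Fin 3) (t : ℕ) : triBdryIter D.verts (D.markDart a) t = bdart D (D.pos a + t) := by
  show triBdryIter D.verts (triBdryIter D.verts D.base (D.pos a)) t = triBdryIter D.verts D.base (D.pos a + t)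
  rw [← triBdryIter_add]

/-- ★ **the sub-arc `∂_{y_a z}` as a position interval**: for the dart `(g, o)` of `z` at position `p` of the stretch `A_a`,
`arcToA D a g o` is the set of tails of the boundary darts at positions `pos a, …, p` (the marked site `v_a` and the hexagon `H_g` of `z`
included). [cite: KhristoforovSmirnov2021, §1.2 (arXiv v1 p. 2: «the counterclockwise arc ∂_{zw}Ω»)] -/
theorem arcToA_eq_image {a : Fin 3} {g o : Site 2} (hd : (g, o) ∈ D.stretch a) :
    arcToA D a g o = ((Finset.Icc (D.pos a) (D.dpos (g, o))).image (bdart D)).image Prod.fst := by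
  classical
  obtain ⟨hpa, -, hL, hbd, -⟩ := dpos_facts_of_mem_stretch hd
  -- for `t < L`: no earlier iterate hits `(g, o)` iff `t ≤ p − pos a`
  have key : ∀ t, t < #(triBdryDarts D.verts) →
      ((∀ s < t, triBdryIter D.verts (D.markDart a) s ≠ (g, o)) ↔ t ≤ D.dpos (g, o) - D.pos a) := by
    intro t ht
    constructor
    · intro h
      by_contra hlt
      push Not at hlt
      exact h _ hlt (by rw [iter_markDart_eq_bdart, Nat.add_sub_cancel' hpa, hbd])
    · intro h s hs heq
      rw [iter_markDart_eq_bdart] at heq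
      have h1 : D.dpos (g, o) = D.pos a + s := D.dpos_eq_of_iter_eq (by omega) heq
      omega
  ext x
  unfold arcToA
  simp only [Finset.mem_image, Finset.mem_filter, Finset.mem_range, Finset.mem_Icc]
  constructor
  · rintro ⟨t, ⟨ht, hall⟩, rfl⟩
    have htle := (key t ht).1 hall
    exact ⟨bdart D (D.pos a + t), ⟨D.pos a + t, ⟨by omega, by omega⟩, rfl⟩, by rw [iter_markDart_eq_bdart]⟩
  · rintro ⟨d, ⟨n, ⟨hn1, hn2⟩, rfl⟩, rfl⟩
    exact ⟨n - D.pos a, ⟨by omega, (key _ (by omega)).2 (by omega)⟩, by rw [iter_markDart_eq_bdart, Nat.add_sub_cancel' hn1]⟩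

/-! ### monotonicity -/

/-- the sub-arc `∂_{y_a z}` grows as `z` advances along `A_a`. [cite: KhristoforovSmirnov2021, §1.2 (arXiv v1 p. 2)] -/
theorem arcToA_mono {a : Fin 3} {g o g' o' : Site 2} (hd : (g, o) ∈ D.stretch a) (hd' : (g', o') ∈ D.stretch a)
    (hle : D.dpos (g, o) ≤ D.dpos (g', o')) : arcToA D a g o ⊆ arcToA D a g' o' := by
  rw [arcToA_eq_image hd, arcToA_eq_image hd']
  exact Finset.image_subset_image (Finset.image_subset_image (Finset.Icc_subset_Icc_right hle))

/-- … hence so does the crossing event `∂_{y_a z} ↔ A_{a+1}`. [cite: KhristoforovSmirnov2021, §2 eq. (4) (arXiv v1 p. 5)] -/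
theorem arcToCrossingA_mono {a : Fin 3} {g o g' o' : Site 2} (hd : (g, o) ∈ D.stretch a) (hd' : (g', o') ∈ D.stretch a)
    (hle : D.dpos (g, o) ≤ D.dpos (g', o')) : arcToCrossingA D a g o ⊆ arcToCrossingA D a g' o' := by
  rintro σ ⟨x, hx, y, hy, hp⟩
  exact ⟨x, arcToA_mono hd hd' hle hx, y, hy, hp⟩

section TwoEdges

variable {a : Fin 3} {g o g' o' : Site 2} (hd : (g, o) ∈ D.stretch a) (hd' : (g', o') ∈ D.stretch a)
  {v v' : HexVertex} {i i' : Fin 3} (he : side v i = s(g, o)) (he' : side v' i' = s(g', o'))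
include hd he

/-- **`F(z) = τ^a + (τ^{a+1} − τ^a)·H_{a+1}(z)`** at every boundary mid-edge `z` of `A_a` (eq. (4) with `H_a + H_{a+1} = 1`): `F(z)` is the
point of the segment `[τ^a, τ^{a+1}]` with barycentric coordinate `H_{a+1}(z)`. [cite: KhristoforovSmirnov2021, §2 eq. (4) and Remark 6 (arXiv v1 p. 5)] -/
theorem fobs_eq_affine : Fobs D v i = tau ^ (a : ℕ) + (tau ^ ((a : ℕ) + 1) - tau ^ (a : ℕ)) * (Hobs D v i (a + 1) : ℂ) := by
  obtain ⟨hg, ho, -⟩ := dart_facts_of_mem_stretch hd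
  obtain ⟨hF, hsum⟩ := fobs_eq_crossingProbs_of_mem_stretch' he hg ho hd
  obtain ⟨h1, h0, -, -⟩ := hobs_eq_prob_of_mem_stretch' he hg ho hd
  rw [hF, h1]
  have h : ((triSitePercolation half).real (arcFromCrossingA D a g o) : ℂ) =
      1 - ((triSitePercolation half).real (arcToCrossingA D a g o) : ℂ) := by
    rw [← Complex.ofReal_one, ← hsum]; push_cast; ring
  rw [h]; ring

include hd' he'

/-- ★ **`H_{a+1}` is non-decreasing along `A_a`**: if the dart of `z'` comes after the dart of `z` on the stretch `A_a` (positions `p ≤ p'`),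
then `H_{a+1}(z) ≤ H_{a+1}(z')`, at whatever faces the two mid-edges are read. [cite: KhristoforovSmirnov2021, §2 eq. (4) (arXiv v1 p. 5)] -/
theorem hobs_succ_mono (hle : D.dpos (g, o) ≤ D.dpos (g', o')) : Hobs D v i (a + 1) ≤ Hobs D v' i' (a + 1) := by
  obtain ⟨hg, ho, -⟩ := dart_facts_of_mem_stretch hd
  obtain ⟨hg', ho', -⟩ := dart_facts_of_mem_stretch hd'
  obtain ⟨h1, -, -, -⟩ := hobs_eq_prob_of_mem_stretch' he hg ho hd
  obtain ⟨h1', -, -, -⟩ := hobs_eq_prob_of_mem_stretch' he' hg' ho' hd'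
  rw [h1, h1']
  exact measureReal_mono (arcToCrossingA_mono hd hd' hle) (measure_ne_top _ _)

/-- ★ **`H_a` is non-increasing along `A_a`**: `H_a(z') ≤ H_a(z)` (as `H_a + H_{a+1} = 1` at every boundary mid-edge of `A_a`).
[cite: KhristoforovSmirnov2021, §2 eq. (4) (arXiv v1 p. 5)] -/
theorem hobs_self_anti (hle : D.dpos (g, o) ≤ D.dpos (g', o')) : Hobs D v' i' a ≤ Hobs D v i a := by
  obtain ⟨hg, ho, -⟩ := dart_facts_of_mem_stretch hd
  obtain ⟨hg', ho', -⟩ := dart_facts_of_mem_stretch hd'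
  obtain ⟨-, -, -, hs⟩ := hobs_eq_prob_of_mem_stretch' he hg ho hd
  obtain ⟨-, -, -, hs'⟩ := hobs_eq_prob_of_mem_stretch' he' hg' ho' hd'
  have h := hobs_succ_mono hd hd' he he' hle
  linarith

/-- the opposite corner stays absent at both mid-edges: `H_{a+2}(z) = H_{a+2}(z') = 0`. [cite: KhristoforovSmirnov2021, §2 eq. (4) (arXiv v1 p. 5)] -/
theorem hobs_add_two_eq : Hobs D v i (a + 2) = 0 ∧ Hobs D v' i' (a + 2) = 0 := by
  obtain ⟨hg, ho, -⟩ := dart_facts_of_mem_stretch hd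
  obtain ⟨hg', ho', -⟩ := dart_facts_of_mem_stretch hd'
  exact ⟨(hobs_eq_prob_of_mem_stretch' he hg ho hd).2.2.1, (hobs_eq_prob_of_mem_stretch' he' hg' ho' hd').2.2.1⟩

/-- ★ **`F` moves along the segment**: `F(z') − F(z) = (τ^{a+1} − τ^a)·(H_{a+1}(z') − H_{a+1}(z))`. [cite: KhristoforovSmirnov2021, §2 eq. (4) and Remark 6 (arXiv v1 p. 5)] -/
theorem fobs_sub_fobs : Fobs D v' i' - Fobs D v i =
    (tau ^ ((a : ℕ) + 1) - tau ^ (a : ℕ)) * ((Hobs D v' i' (a + 1) : ℂ) - (Hobs D v i (a + 1) : ℂ)) := by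
  rw [fobs_eq_affine hd he, fobs_eq_affine hd' he']
  ring

/-- ★★ **MONOTONE BOUNDARY CORRESPONDENCE (discrete)**: as `z` advances along `A_a`, `F(z)` moves from `τ^a` towards `τ^{a+1}` —
the increment `F(z') − F(z)` is a non-negative real multiple of the side vector `τ^{a+1} − τ^a`.
[cite: KhristoforovSmirnov2021, §2 eq. (4), Remark 6 (arXiv v1 p. 5); §3 (pp. 5–6)] -/
theorem fobs_monotone_on_arc (hle : D.dpos (g, o) ≤ D.dpos (g', o')) : ∃ t : ℝ, 0 ≤ t ∧ t ≤ 1 ∧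
    Fobs D v' i' - Fobs D v i = (t : ℂ) * (tau ^ ((a : ℕ) + 1) - tau ^ (a : ℕ)) := by
  obtain ⟨hg', ho', -⟩ := dart_facts_of_mem_stretch hd'
  refine ⟨Hobs D v' i' (a + 1) - Hobs D v i (a + 1), sub_nonneg.2 (hobs_succ_mono hd hd' he he' hle), ?_, ?_⟩
  · have h1 : Hobs D v' i' (a + 1) ≤ 1 := by
      obtain ⟨-, -, -, hs'⟩ := hobs_eq_prob_of_mem_stretch' he' hg' ho' hd'
      have := hobs_nonneg D v' i' a
      linarith
    have h0 : 0 ≤ Hobs D v i (a + 1) := hobs_nonneg D v i (a + 1)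
    linarith
  · rw [fobs_sub_fobs hd hd' he he']
    push_cast
    ring

end TwoEdges

/-! ### (T-SITE at `k = 3`): the boundary trace is a function of the boundary HEXAGON

The boundary cycle of a marked discrete domain visits each boundary site once (`TriMarkedDomain.tail_not_interleaved`: no cut
vertex), so the darts of a stretch with a given tail `g` occupy consecutive positions; the sub-arc `∂_{y_a z}` read at two of them
differs only by the site `g` itself, which it already contains. Hence `H_j` and `F` take the same value at all boundary mid-edges of
`A_a` around the same hexagon `H_g` — the three-disorder twin of the five-point site law `Bdry.boundarySiteLaw_holds`. -/

section SiteLaw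

/-- there is a mark other than `a` whose site is not `u` (the three marked sites are distinct). [cite: BollobasRiordan2006, Ch. 7 §7.2.2 pp. 191–193] -/
theorem exists_mark_ne_of_ne₃ (a : Fin 3) (u : Site 2) : ∃ a' : Fin 3, a' ≠ a ∧ D.markSite a' ≠ u := by
  by_contra h
  push Not at h
  have ne1 : ∀ i : Fin 3, i + 1 ≠ i := by decide
  have ne2 : ∀ i : Fin 3, i + 2 ≠ i := by decide
  have ne12 : ∀ i : Fin 3, i + 1 ≠ i + 2 := by decide
  have h1 : D.markSite (a + 1) = u := h (a + 1) (ne1 a)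
  have h2 : D.markSite (a + 2) = u := h (a + 2) (ne2 a)
  exact ne12 a (D.mark_injective (h1.trans h2.symm))

/-- a mark `a' ≠ a` sits outside the position interval `[pos a, nextPos a)`. [cite: BollobasRiordan2006, Ch. 7 §7.2.2 pp. 191–193] -/
theorem pos_lt_or_nextPos_le₃ {a a' : Fin 3} (h : a' ≠ a) : D.pos a' < D.pos a ∨ D.nextPos a ≤ D.pos a' := by
  rcases lt_or_gt_of_ne h with hlt | hgt
  · exact Or.inl (D.pos_strictMono hlt)
  · right
    have hij : a.val < a'.val := hgt
    have ha : a.val + 1 < 3 := by omega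
    rw [D.nextPos_of_lt₃ a ha]
    exact D.pos_strictMono.monotone (show (⟨a.val + 1, ha⟩ : Fin 3) ≤ a' from Nat.succ_le_of_lt hij)

/-- **the run of a boundary hexagon inside a stretch** (`k = 3`): if the darts at two positions `n ≤ n'` of the stretch `A_a` have the
same tail `u`, so does the dart at every position in between. [cite: BollobasRiordan2006, Ch. 7 §7.2.2 p. 192 («we do not visit the same vertex of ∂⁻(G) … more than once»)] -/
theorem fst_bdart_eq_of_between₃ {a : Fin 3} {n n' : ℕ} (hn : D.pos a ≤ n) (hnn' : n ≤ n') (hn' : n' < D.nextPos a) {u : Site 2}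
    (hu : (bdart D n).1 = u) (hu' : (bdart D n').1 = u) {j : ℕ} (hnj : n ≤ j) (hjn' : j ≤ n') : (bdart D j).1 = u := by
  rcases eq_or_lt_of_le hnj with rfl | hnj
  · exact hu
  rcases eq_or_lt_of_le hjn' with rfl | hjn'
  · exact hu'
  by_contra hj
  have hN : D.nextPos a ≤ #(triBdryDarts D.verts) := D.nextPos_le_bdryLen a
  obtain ⟨a', ha'a, ha'u⟩ := exists_mark_ne_of_ne₃ (D := D) a u
  have hmark : (bdart D (D.pos a')).1 ≠ u := ha'u
  rcases pos_lt_or_nextPos_le₃ (D := D) ha'a with hlt | hge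
  · -- the mark `a'` comes before the stretch: read the cycle from position `n`
    have hb : bdart D n ∈ triBdryDarts D.verts := bdart_mem n
    have hshift : ∀ m, triBdryIter D.verts (bdart D n) m = bdart D (n + m) := fun m =>
      (triBdryIter_add D.verts D.base n m).symm
    have h4 : (triBdryIter D.verts (bdart D n) (D.pos a' + #(triBdryDarts D.verts) - n)).1 ≠ u := by
      rw [hshift, show n + (D.pos a' + #(triBdryDarts D.verts) - n) = D.pos a' + #(triBdryDarts D.verts) by omega]
      show (triBdryIter D.verts D.base (D.pos a' + #(triBdryDarts D.verts))).1 ≠ u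
      rw [D.isTriDisc.iter_add_card]
      exact hmark
    rcases D.tail_not_interleaved hb (u := u) (n₁ := 0) (n₂ := j - n) (n₃ := n' - n)
        (n₄ := D.pos a' + #(triBdryDarts D.verts) - n) (by omega) (by omega) (by omega) (by omega)
        (by rw [hshift, Nat.add_zero]; exact hu) (by rw [hshift, show n + (n' - n) = n' by omega]; exact hu') with h | h
    · rw [hshift, show n + (j - n) = j by omega] at h
      exact hj h
    · exact h4 h
  · -- the mark `a'` comes after the stretch: read the cycle from the base
    rcases D.tail_not_interleaved D.base_mem (u := u) hnj hjn' (lt_of_lt_of_le hn' hge) (D.pos_lt a') hu hu' with h | h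
    · exact hj h
    · exact hmark h

/-- ★ **two darts of `A_a` with the same tail have the same sub-arc `∂_{y_a z}`** (as a set of hexagons). [cite: BollobasRiordan2006, Ch. 7 §7.2.2 p. 192] -/
theorem arcToA_eq_of_fst_eq {a : Fin 3} {g o o' : Site 2} (hd : (g, o) ∈ D.stretch a) (hd' : (g, o') ∈ D.stretch a) :
    arcToA D a g o = arcToA D a g o' := by
  classical
  -- without loss of generality `p ≤ p'`
  suffices key : ∀ {o₁ o₂ : Site 2}, (g, o₁) ∈ D.stretch a → (g, o₂) ∈ D.stretch a → D.dpos (g, o₁) ≤ D.dpos (g, o₂) →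
      arcToA D a g o₂ ⊆ arcToA D a g o₁ by
    rcases le_total (D.dpos (g, o)) (D.dpos (g, o')) with h | h
    · exact Finset.Subset.antisymm (arcToA_mono hd hd' h) (key hd hd' h)
    · exact Finset.Subset.antisymm (key hd' hd h) (arcToA_mono hd' hd h)
  intro o₁ o₂ h₁ h₂ hle x hx
  obtain ⟨hp1, -, -, hb1, -⟩ := dpos_facts_of_mem_stretch h₁
  obtain ⟨-, hn2, -, hb2, -⟩ := dpos_facts_of_mem_stretch h₂
  rw [arcToA_eq_image h₂] at hx
  rw [arcToA_eq_image h₁]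
  simp only [Finset.mem_image, Finset.mem_Icc] at hx ⊢
  obtain ⟨d, ⟨m, ⟨hm1, hm2⟩, rfl⟩, rfl⟩ := hx
  by_cases hm : m ≤ D.dpos (g, o₁)
  · exact ⟨bdart D m, ⟨m, ⟨hm1, hm⟩, rfl⟩, rfl⟩
  · -- a position between `p` and `p'`: its tail is `g`, already the tail of position `p`
    push Not at hm
    have hg : (bdart D m).1 = g :=
      fst_bdart_eq_of_between₃ hp1 hle hn2 (by rw [hb1]) (by rw [hb2]) hm.le hm2
    exact ⟨bdart D (D.dpos (g, o₁)), ⟨D.dpos (g, o₁), ⟨hp1, le_rfl⟩, rfl⟩, by rw [hb1]; exact hg.symm⟩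

/-- … hence the same crossing event. [cite: KhristoforovSmirnov2021, §2 eq. (4) (arXiv v1 p. 5)] -/
theorem arcToCrossingA_eq_of_fst_eq {a : Fin 3} {g o o' : Site 2} (hd : (g, o) ∈ D.stretch a) (hd' : (g, o') ∈ D.stretch a) :
    arcToCrossingA D a g o = arcToCrossingA D a g o' := by
  unfold arcToCrossingA; rw [arcToA_eq_of_fst_eq hd hd']

/-- ★★ **(T-SITE, `k = 3`) the three-disorder observable on the boundary is a function of the boundary HEXAGON**: two boundary
mid-edges of `A_a` around the same hexagon `H_g` carry the same `H_0, H_1, H_2` (read at any faces). [cite: KhristoforovSmirnov2021, §2 eq. (4) (arXiv v1 p. 5)] -/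
theorem hobs_site_law₃ {a : Fin 3} {g o o' : Site 2} (hd : (g, o) ∈ D.stretch a) (hd' : (g, o') ∈ D.stretch a)
    {v v' : HexVertex} {i i' : Fin 3} (he : side v i = s(g, o)) (he' : side v' i' = s(g, o')) (j : Fin 3) :
    Hobs D v i j = Hobs D v' i' j := by
  obtain ⟨hg, ho, -⟩ := dart_facts_of_mem_stretch hd
  obtain ⟨-, ho', -⟩ := dart_facts_of_mem_stretch hd'
  obtain ⟨h1, -, h2, hs⟩ := hobs_eq_prob_of_mem_stretch' he hg ho hd
  obtain ⟨h1', -, h2', hs'⟩ := hobs_eq_prob_of_mem_stretch' he' hg ho' hd'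
  have hsucc : Hobs D v i (a + 1) = Hobs D v' i' (a + 1) := by rw [h1, h1', arcToCrossingA_eq_of_fst_eq hd hd']
  have h3 : ∀ j' : Fin 3, j' = a ∨ j' = a + 1 ∨ j' = a + 2 := by
    intro j'; have : ∀ a j' : Fin 3, j' = a ∨ j' = a + 1 ∨ j' = a + 2 := by decide
    exact this a j'
  rcases h3 j with rfl | rfl | rfl
  · linarith
  · exact hsucc
  · rw [h2, h2']

/-- ★★ **… and the same `F`.** [cite: KhristoforovSmirnov2021, §2 eq. (4) (arXiv v1 p. 5)] -/
theorem fobs_site_law₃ {a : Fin 3} {g o o' : Site 2} (hd : (g, o) ∈ D.stretch a) (hd' : (g, o') ∈ D.stretch a)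
    {v v' : HexVertex} {i i' : Fin 3} (he : side v i = s(g, o)) (he' : side v' i' = s(g, o')) :
    Fobs D v i = Fobs D v' i' := by
  unfold Fobs
  exact Finset.sum_congr rfl fun j _ => by rw [hobs_site_law₃ hd hd' he he' j]

end SiteLaw

end Monotone

end Literature.Probability.Percolation.MarkedLoops
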